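import Mathlib.Data.Nat.Choose.Lucas
import Mathlib.Data.Nat.Choose.Sum
import Mathlib.RingTheory.MvPolynomial.Basic
import Mathlib.Algebra.MvPolynomial.Degrees
import Mathlib.Algebra.Field.ZMod
import Mathlib.Algebra.Order.Field.GeomSum
import Mathlib.Analysis.SpecialFunctions.Log.Basic
import Mathlib.NumberTheory.Bertrand
import HarnessLib

/-!
# Unbalancing sets under a balanced partition (Alon–Kumar–Volk 2020, §3)

Support file for the proof of `Literature.Barriers.ValiantsHypothesis.AlonKumarVolk2020_thm20`
(`FullRankMultilinear.lean`): the combinatorial heart of [AlonKumarVolk2020], an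
*unbalancing-sets theorem* of the strength of [AlonKumarVolk2020, Thm. 3 / Thm. 13] for the
parameters needed by the circuit lower bound (`exists_balanced_unbalancing`): if a family of
`m` subsets of an `N`-set (`N` even) has all sizes in `[C(τ+8), N - C(τ+8)]` and
`16 τ m < N ≤ 2^τ`, then some balanced `Y` (`|Y| = N/2`) is `τ`-unbalanced on every member,
`| |Y ∩ S| - |S|/2 | ≥ τ`.

## The argument formalised here (all constants are immaterial for Theorem 20)

* `eval_indVec_eq_zero_of_layer` — **Hegedűs's lemma** [AlonKumarVolk2020, Lemma 5] in a
  generalized and ELEMENTARY form (the source knows only the Gröbner-basis proof of Hegedűs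
  2010 and asks for an elementary one, §1.3): for a prime `p`, `k ≥ 1` with `p ∤ k`, and
  `P ∈ 𝔽_p[x]` of degree `< p`, if `P(𝟙_Y) = 0` for all `kp`-subsets `Y` of a `(k+1)p`-set
  `T` then `P(𝟙_T) = 0`. Proof: double counting `∑_{Y ⊆ T', |Y| = kp} P(𝟙_Y)` over a
  `(kp + deg P)`-set `T'` and Lucas's theorem give `coeff_0 P = 0`; the same sum over `T`
  is `≡ k · P(𝟙_T) + coeff_0 P`.
* `card_upperTail_le`, `card_lowerTail_le` — hypergeometric tails in counting form (the role
  of [AlonKumarVolk2020, Lemma 6]), by the ratio of consecutive levels.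
* `exists_balanced_unbalancing` — the theorem, for EVERY large even `N` without the prime-gap
  input of [AlonKumarVolk2020, §3.2]: take a Bertrand prime `p ∈ (N/8, N/4]`, write
  `N/2 = kp + r` (`k ∈ {2, 3}`), choose `U`, `|U| = N/2 + p`, with
  `|U ∩ S| - |S|/2 ∈ [2τ, p - 2τ]` for all members (tails + union bound; members of size
  `> N/2` through their complements), fix `r` points `B ⊆ U`, and apply Hegedűs's lemma on
  `[N] ∖ B` to `P = ∏_S ∏_{a : |2a-|S|| < 2τ} (∑_{i ∈ S ∖ B} x_i + |S ∩ B| - a)` (degree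
  `≤ 2τ m < p`, vanishing on the layer `kp` if every balanced `Y` balances some member, as in
  the proof of [AlonKumarVolk2020, Thm. 9]) and `T = U ∖ B`: `P(𝟙_T) ≠ 0`, contradiction.

## References
* [AlonKumarVolk2020] N. Alon, M. Kumar, B. L. Volk, *Unbalancing sets and an almost quadratic
  lower bound for syntactically multilinear arithmetic circuits*, Combinatorica 40 (2020)
  149–178 (arXiv:1708.02037: §2 Lemma 5, Lemma 6; §3 Thm. 9, Lemma 10, Thm. 13).
-/

namespace Literature.Barriers.ValiantsHypothesis.AKV

open MvPolynomial Finset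

section Hegedus

variable {p : ℕ} {M : ℕ}

/-- The `0/1` indicator vector `𝟙_T ∈ 𝔽_p^M` of a set of coordinates `T`.
[cite: AlonKumarVolk2020, §2 (characteristic vector `𝟙_S`)] -/
def indVec (T : Finset (Fin M)) : Fin M → ZMod p := fun i => if i ∈ T then 1 else 0

/-- Evaluating a polynomial at an indicator vector `𝟙_T` adds up the coefficients of the
monomials whose support lies inside `T`. [folklore] -/
theorem eval_indVec (P : MvPolynomial (Fin M) (ZMod p)) (T : Finset (Fin M)) :
    eval (indVec T) P = ∑ m ∈ P.support.filter (fun m => m.support ⊆ T), coeff m P := by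
  rw [eval_eq, Finset.sum_filter]
  refine Finset.sum_congr rfl fun m _ => ?_
  by_cases h : m.support ⊆ T
  · rw [if_pos h, Finset.prod_eq_one, mul_one]
    intro i hi
    simp [indVec, h hi]
  · rw [if_neg h]
    obtain ⟨i, hi, hiT⟩ := Finset.not_subset.1 h
    rw [Finset.prod_eq_zero hi, mul_zero]
    simp only [indVec, if_neg hiT]
    exact zero_pow (Finsupp.mem_support_iff.1 hi)

/-- The number of `K`-subsets of `T` containing a fixed subset `A ⊆ T` with `|A| ≤ K` is
`C(|T| - |A|, K - |A|)`. [folklore] -/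
theorem card_filter_powersetCard_superset {α : Type*} [DecidableEq α] {T A : Finset α}
    (hA : A ⊆ T) {K : ℕ} (hK : A.card ≤ K) :
    ((T.powersetCard K).filter (fun Y => A ⊆ Y)).card = (T.card - A.card).choose (K - A.card) := by
  rw [← Finset.card_sdiff_of_subset hA, ← Finset.card_powersetCard (K - A.card) (T \ A)]
  refine Finset.card_nbij' (fun Y => Y \ A) (fun Z => Z ∪ A) ?_ ?_ ?_ ?_
  · intro Y hY
    rw [Finset.mem_coe, Finset.mem_filter, Finset.mem_powersetCard] at hY
    rw [Finset.mem_coe, Finset.mem_powersetCard]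
    exact ⟨Finset.sdiff_subset_sdiff hY.1.1 (subset_refl _),
      by rw [Finset.card_sdiff_of_subset hY.2, hY.1.2]⟩
  · intro Z hZ
    rw [Finset.mem_coe, Finset.mem_powersetCard] at hZ
    rw [Finset.mem_coe, Finset.mem_filter, Finset.mem_powersetCard]
    have hdisj : Disjoint Z A := Finset.disjoint_of_subset_left hZ.1 Finset.sdiff_disjoint
    refine ⟨⟨Finset.union_subset (hZ.1.trans Finset.sdiff_subset) hA, ?_⟩,
      Finset.subset_union_right⟩
    rw [Finset.card_union_of_disjoint hdisj, hZ.2]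
    omega
  · intro Y hY
    rw [Finset.mem_coe, Finset.mem_filter] at hY
    exact Finset.sdiff_union_of_subset hY.2
  · intro Z hZ
    rw [Finset.mem_coe, Finset.mem_powersetCard] at hZ
    exact Finset.union_sdiff_cancel_right
      (Finset.disjoint_of_subset_left hZ.1 Finset.sdiff_disjoint)

/-- **Double counting.** Summing `P(𝟙_Y)` over the `K`-subsets `Y` of `T` counts every monomial
supported in `T` with multiplicity `C(|T| - |m|, K - |m|)`. [folklore] -/
theorem sum_powersetCard_eval_indVec (P : MvPolynomial (Fin M) (ZMod p)) (T : Finset (Fin M))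
    (K : ℕ) (hK : ∀ m ∈ P.support, m.support.card ≤ K) :
    ∑ Y ∈ T.powersetCard K, eval (indVec Y) P =
      ∑ m ∈ P.support.filter (fun m => m.support ⊆ T),
        (((T.card - m.support.card).choose (K - m.support.card) : ℕ) : ZMod p) * coeff m P := by
  calc ∑ Y ∈ T.powersetCard K, eval (indVec Y) P
      = ∑ Y ∈ T.powersetCard K, ∑ m ∈ P.support,
          (if m.support ⊆ Y then coeff m P else 0) := by
        refine Finset.sum_congr rfl fun Y _ => ?_
        rw [eval_indVec, Finset.sum_filter]
    _ = ∑ m ∈ P.support, ∑ Y ∈ T.powersetCard K,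
          (if m.support ⊆ Y then coeff m P else 0) := Finset.sum_comm
    _ = ∑ m ∈ P.support,
          ((((T.powersetCard K).filter (fun Y => m.support ⊆ Y)).card : ℕ) : ZMod p) *
            coeff m P := by
        refine Finset.sum_congr rfl fun m _ => ?_
        rw [← Finset.sum_filter, Finset.sum_const, nsmul_eq_mul]
    _ = _ := by
        rw [Finset.sum_filter]
        refine Finset.sum_congr rfl fun m hm => ?_
        by_cases h : m.support ⊆ T
        · rw [if_pos h, card_filter_powersetCard_superset h (hK m hm)]
        · rw [if_neg h]
          have he : (T.powersetCard K).filter (fun Y => m.support ⊆ Y) = ∅ := by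
            rw [Finset.filter_eq_empty_iff]
            intro Y hY hAY
            exact h (hAY.trans (Finset.mem_powersetCard.1 hY).1)
          rw [he, Finset.card_empty, Nat.cast_zero, zero_mul]

section Prime

variable [hp : Fact p.Prime]

/-- Lucas's theorem, one base-`p` digit, read in `𝔽_p`. [folklore] -/
theorem cast_choose_eq_lucas (n r : ℕ) :
    ((n.choose r : ℕ) : ZMod p) = (((n % p).choose (r % p) * (n / p).choose (r / p) : ℕ) : ZMod p) :=
  (ZMod.natCast_eq_natCast_iff _ _ _).2 Choose.choose_modEq_choose_mod_mul_choose_div_nat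

/-- First Lucas evaluation: for `d < p`, `a ≤ d`, `k ≥ 1`,
`C(kp + d - a, kp - a) ≡ [a = 0] (mod p)`. [folklore] -/
theorem choose_layer_one {k d a : ℕ} (hk : 1 ≤ k) (hd : d < p) (ha : a ≤ d) :
    (((k * p + d - a).choose (k * p - a) : ℕ) : ZMod p) = if a = 0 then 1 else 0 := by
  have hp0 : 0 < p := hp.out.pos
  rw [cast_choose_eq_lucas]
  rcases Nat.eq_zero_or_pos a with rfl | ha0
  · rw [if_pos rfl]
    have e1 : k * p + d - 0 = d + p * k := by rw [Nat.mul_comm p k]; omega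
    have e2 : k * p - 0 = 0 + p * k := by rw [Nat.mul_comm p k]; omega
    rw [e1, e2, Nat.add_mul_mod_self_left, Nat.add_mul_mod_self_left, Nat.add_mul_div_left _ _ hp0,
      Nat.add_mul_div_left _ _ hp0, Nat.mod_eq_of_lt hd, Nat.zero_mod, Nat.div_eq_of_lt hd,
      Nat.zero_div]
    simp
  · rw [if_neg (by omega)]
    have e1 : k * p + d - a = (d - a) + p * k := by rw [Nat.mul_comm p k]; omega
    have e2 : k * p - a = (p - a) + p * (k - 1) := by
      rcases Nat.exists_eq_add_of_le hk with ⟨k', rfl⟩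
      rw [Nat.add_sub_cancel_left, Nat.add_mul, one_mul, Nat.mul_comm p k']
      omega
    have hda : d - a < p := by omega
    have hpa : p - a < p := by omega
    rw [e1, e2, Nat.add_mul_mod_self_left, Nat.add_mul_mod_self_left, Nat.mod_eq_of_lt hda,
      Nat.mod_eq_of_lt hpa, Nat.choose_eq_zero_of_lt (by omega : d - a < p - a), zero_mul,
      Nat.cast_zero]

/-- Second Lucas evaluation: for `a < p`, `k ≥ 1`,
`C((k+1)p - a, kp - a) ≡ k + [a = 0] (mod p)`. [folklore] -/
theorem choose_layer_two {k a : ℕ} (hk : 1 ≤ k) (ha : a < p) :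
    ((((k + 1) * p - a).choose (k * p - a) : ℕ) : ZMod p) =
      (k : ZMod p) + (if a = 0 then 1 else 0) := by
  have hp0 : 0 < p := hp.out.pos
  rw [cast_choose_eq_lucas]
  rcases Nat.eq_zero_or_pos a with rfl | ha0
  · rw [if_pos rfl]
    have e1 : (k + 1) * p - 0 = 0 + p * (k + 1) := by rw [Nat.mul_comm p (k + 1)]; omega
    have e2 : k * p - 0 = 0 + p * k := by rw [Nat.mul_comm p k]; omega
    rw [e1, e2, Nat.add_mul_mod_self_left, Nat.add_mul_mod_self_left, Nat.add_mul_div_left _ _ hp0,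
      Nat.add_mul_div_left _ _ hp0, Nat.zero_mod, Nat.zero_div, Nat.zero_add, Nat.zero_add,
      Nat.choose_zero_right, one_mul, Nat.choose_succ_self_right]
    push_cast
    rfl
  · rw [if_neg (by omega), add_zero]
    have e1 : (k + 1) * p - a = (p - a) + p * k := by
      rw [Nat.add_mul, one_mul, Nat.mul_comm p k]; omega
    have e2 : k * p - a = (p - a) + p * (k - 1) := by
      rcases Nat.exists_eq_add_of_le hk with ⟨k', rfl⟩
      rw [Nat.add_sub_cancel_left, Nat.add_mul, one_mul, Nat.mul_comm p k']
      omega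
    have hpa : p - a < p := by omega
    rw [e1, e2, Nat.add_mul_mod_self_left, Nat.add_mul_mod_self_left, Nat.mod_eq_of_lt hpa,
      Nat.add_mul_div_left _ _ hp0, Nat.add_mul_div_left _ _ hp0, Nat.div_eq_of_lt hpa,
      Nat.zero_add, Nat.zero_add, Nat.choose_self, one_mul]
    rcases Nat.exists_eq_add_of_le hk with ⟨k', rfl⟩
    rw [Nat.add_sub_cancel_left, Nat.add_comm 1 k', Nat.choose_succ_self_right]

/-- The support of a monomial of `P` has at most `totalDegree P` elements. [folklore] -/
theorem card_support_le_totalDegree {R σ : Type*} [CommSemiring R] {P : MvPolynomial σ R}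
    {m : σ →₀ ℕ} (hm : m ∈ P.support) : m.support.card ≤ P.totalDegree := by
  refine le_trans ?_ (le_totalDegree hm)
  rw [Finsupp.sum, Finset.card_eq_sum_ones]
  exact Finset.sum_le_sum fun i hi => Nat.one_le_iff_ne_zero.2 (Finsupp.mem_support_iff.1 hi)

/-- **Hegedűs's lemma, generalized, elementary form** (via Lucas's theorem). Let `p` be a
prime, `k ≥ 1` with `p ∤ k`, and `P ∈ 𝔽_p[x_1, …, x_M]` of total degree `< p`. If `T` has
`(k+1)p` elements and `P(𝟙_Y) = 0` for every `Y ⊆ T` with `|Y| = kp`, then `P(𝟙_T) = 0`.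
(For `k = 2`, `M = 4p` this is [AlonKumarVolk2020, Lemma 5] = Hegedűs 2010, in contrapositive
form: a polynomial vanishing on the middle layer and not at some weight-`3p` point has degree
`≥ p`.) [cite: AlonKumarVolk2020, Lemma 5] -/
theorem eval_indVec_eq_zero_of_layer {k : ℕ} (hk : 1 ≤ k) (hpk : ¬ p ∣ k)
    (P : MvPolynomial (Fin M) (ZMod p)) (hdeg : P.totalDegree < p)
    (T : Finset (Fin M)) (hT : T.card = (k + 1) * p)
    (hvan : ∀ Y ⊆ T, Y.card = k * p → eval (indVec Y) P = 0) :
    eval (indVec T) P = 0 := by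
  set d := P.totalDegree with hd
  have hsupp : ∀ m ∈ P.support, m.support.card ≤ d := fun m hm => card_support_le_totalDegree hm
  have hpkp : p ≤ k * p := Nat.le_mul_of_pos_left p hk
  have hcard0 : ∀ m : Fin M →₀ ℕ, m ≠ 0 → m.support.card ≠ 0 := fun m hm0 => by
    rwa [Ne, Finset.card_eq_zero, Finsupp.support_eq_empty]
  -- Step 1: the constant coefficient vanishes (sum over the `kp`-subsets of a `(kp + d)`-set).
  have h0 : coeff 0 P = 0 := by
    obtain ⟨T', hT'T, hT'card⟩ := Finset.exists_subset_card_eq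
      (show k * p + d ≤ T.card by rw [hT, Nat.add_mul, one_mul]; omega)
    have hsum : ∑ Y ∈ T'.powersetCard (k * p), eval (indVec Y) P = 0 :=
      Finset.sum_eq_zero fun Y hY => hvan Y ((Finset.mem_powersetCard.1 hY).1.trans hT'T)
        (Finset.mem_powersetCard.1 hY).2
    rw [sum_powersetCard_eval_indVec P T' (k * p) (fun m hm => (hsupp m hm).trans (by omega))]
      at hsum
    have key : ∀ m ∈ P.support.filter (fun m => m.support ⊆ T'),
        (((T'.card - m.support.card).choose (k * p - m.support.card) : ℕ) : ZMod p) * coeff m P =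
          if m = 0 then coeff m P else 0 := by
      intro m hm
      have hm' := (Finset.mem_filter.1 hm).1
      rw [hT'card, choose_layer_one hk hdeg (hsupp m hm')]
      by_cases hm0 : m = 0
      · simp [hm0]
      · simp [hcard0 m hm0, hm0]
    rw [Finset.sum_congr rfl key, Finset.sum_ite_eq'] at hsum
    by_cases hz : (0 : Fin M →₀ ℕ) ∈ P.support
    · rwa [if_pos (Finset.mem_filter.2 ⟨hz, by simp⟩)] at hsum
    · exact notMem_support_iff.1 hz
  -- Step 2: the sum over the `kp`-subsets of `T` is `k · P(𝟙_T) + coeff 0 P`.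
  have hsum2 : ∑ Y ∈ T.powersetCard (k * p), eval (indVec Y) P = 0 :=
    Finset.sum_eq_zero fun Y hY => hvan Y (Finset.mem_powersetCard.1 hY).1
      (Finset.mem_powersetCard.1 hY).2
  rw [sum_powersetCard_eval_indVec P T (k * p) (fun m hm => (hsupp m hm).trans (by omega))]
    at hsum2
  have key2 : ∀ m ∈ P.support.filter (fun m => m.support ⊆ T),
      (((T.card - m.support.card).choose (k * p - m.support.card) : ℕ) : ZMod p) * coeff m P =
        (k : ZMod p) * coeff m P + (if m = 0 then coeff m P else 0) := by
    intro m hm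
    have hm' := (Finset.mem_filter.1 hm).1
    rw [hT, choose_layer_two hk ((hsupp m hm').trans_lt hdeg)]
    by_cases hm0 : m = 0
    · simp [hm0, add_mul]
    · simp [hcard0 m hm0, hm0]
  rw [Finset.sum_congr rfl key2, Finset.sum_add_distrib, Finset.sum_ite_eq', ← Finset.mul_sum,
    ← eval_indVec] at hsum2
  have hif : (if (0 : Fin M →₀ ℕ) ∈ P.support.filter (fun m => m.support ⊆ T)
      then coeff 0 P else 0) = 0 := by
    split_ifs <;> simp [h0]
  rw [hif, add_zero] at hsum2
  have hk0 : (k : ZMod p) ≠ 0 := by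
    rwa [Ne, ZMod.natCast_eq_zero_iff]
  exact (mul_eq_zero.1 hsum2).resolve_left hk0

end Prime

end Hegedus


section Tail

variable {α : Type*} [Fintype α] [DecidableEq α]

/-- `cnt S u i` = the number of `u`-subsets of the universe meeting `S` in exactly `i` points
(the hypergeometric distribution, unnormalised). [cite: AlonKumarVolk2020, §2.1] -/
def cnt (S : Finset α) (u i : ℕ) : ℕ :=
  (((univ : Finset α).powersetCard u).filter (fun U => (U ∩ S).card = i)).card

/-- `cnt S u i = C(|S|, i) · C(N - |S|, u - i)` for `i ≤ u`. [cite: AlonKumarVolk2020, §2.1] -/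
theorem cnt_eq (S : Finset α) {u i : ℕ} (hi : i ≤ u) :
    cnt S u i = S.card.choose i * (Fintype.card α - S.card).choose (u - i) := by
  unfold cnt
  rw [← Finset.card_compl S, ← Finset.card_powersetCard, ← Finset.card_powersetCard,
    ← Finset.card_product]
  refine Finset.card_nbij' (fun U => (U ∩ S, U \ S)) (fun AB => AB.1 ∪ AB.2) ?_ ?_ ?_ ?_
  · intro U hU
    rw [mem_coe, mem_filter, mem_powersetCard] at hU
    rw [mem_coe, mem_product, mem_powersetCard, mem_powersetCard]
    refine ⟨⟨inter_subset_right, hU.2⟩, fun x hx => mem_compl.2 (mem_sdiff.1 hx).2, ?_⟩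
    have h1 := Finset.card_sdiff_add_card_inter U S
    have h2 := hU.2
    have h3 := hU.1.2
    show (U \ S).card = u - i
    omega
  · rintro ⟨A, B⟩ hAB
    rw [mem_coe, mem_product, mem_powersetCard, mem_powersetCard] at hAB
    obtain ⟨⟨hAS, hAc⟩, hBS, hBc⟩ := hAB
    have hdisj : Disjoint A B := by
      rw [Finset.disjoint_left]
      intro x hxA hxB
      exact (mem_compl.1 (hBS hxB)) (hAS hxA)
    rw [mem_coe, mem_filter, mem_powersetCard]
    have hcardAB : (A ∪ B).card = u := by
      rw [card_union_of_disjoint hdisj, hAc, hBc]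
      omega
    refine ⟨⟨subset_univ _, hcardAB⟩, ?_⟩
    have : (A ∪ B) ∩ S = A := by
      ext x
      simp only [mem_inter, mem_union]
      constructor
      · rintro ⟨hx | hx, hxS⟩
        · exact hx
        · exact absurd hxS (mem_compl.1 (hBS hx))
      · intro hx
        exact ⟨Or.inl hx, hAS hx⟩
    show ((A ∪ B) ∩ S).card = i
    rw [this, hAc]
  · intro U _
    ext x
    simp only [mem_union, mem_inter, mem_sdiff]
    tauto
  · rintro ⟨A, B⟩ hAB
    rw [mem_coe, mem_product, mem_powersetCard, mem_powersetCard] at hAB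
    obtain ⟨⟨hAS, -⟩, hBS, -⟩ := hAB
    have hB : ∀ x ∈ B, x ∉ S := fun x hx => mem_compl.1 (hBS hx)
    refine Prod.ext ?_ ?_
    · ext x
      simp only [mem_inter, mem_union]
      constructor
      · rintro ⟨hx | hx, hxS⟩
        · exact hx
        · exact absurd hxS (hB x hx)
      · intro hx
        exact ⟨Or.inl hx, hAS hx⟩
    · ext x
      simp only [mem_sdiff, mem_union]
      constructor
      · rintro ⟨hx | hx, hxS⟩
        · exact absurd (hAS hx) hxS
        · exact hx
      · intro hx
        exact ⟨Or.inr hx, hB x hx⟩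

/-- Every level is bounded by the total number `C(N, u)` of `u`-subsets. [folklore] -/
theorem cnt_le_choose (S : Finset α) (u i : ℕ) : cnt S u i ≤ (Fintype.card α).choose u := by
  unfold cnt
  calc _ ≤ ((univ : Finset α).powersetCard u).card := card_filter_le _ _
    _ = _ := by rw [card_powersetCard, card_univ]

/-- A quadratic inequality: for `0 ≤ q`, `0 ≤ δ ≤ 1/4`, `2q(1 - q - δ) ≤ 1 - 2δ`. [folklore] -/
theorem two_mul_q_ineq {q δ : ℝ} (hq : 0 ≤ q) (hδ : 0 ≤ δ) (hδ4 : δ ≤ 1 / 4) :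
    2 * q * (1 - q - δ) ≤ 1 - 2 * δ := by
  nlinarith [sq_nonneg (2 * q - 1), mul_nonneg hq hδ]

/-- The real-arithmetic core of the ratio step: from the exact identity
`A (i+1) (N - s - (u - i - 1)) = B (s - i)(u - i)` between consecutive hypergeometric levels
and `i ≥ (u/N + δ) s` one gets `A ≤ (1 - 2δ) B`. [folklore] -/
theorem ratio_real {N s u i δ A B : ℝ} (hN : 0 < N) (hδ : 0 < δ) (hδ4 : δ ≤ 1 / 4)
    (huN : u < N) (hsN : s ≤ N) (hB0 : 0 ≤ B)
    (his : i + 1 ≤ s) (hiu : i + 1 ≤ u) (hi0 : 0 ≤ i)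
    (hi : (u / N + δ) * s ≤ i)
    (hid : A * ((i + 1) * (N - s - (u - (i + 1)))) = B * ((s - i) * (u - i))) :
    A ≤ (1 - 2 * δ) * B := by
  set q : ℝ := u / N with hqdef
  have hqN : q * N = u := by rw [hqdef]; field_simp
  have hu0 : 0 ≤ u := by linarith
  have hq0 : 0 ≤ q := by positivity
  have hq1 : q < 1 := by rwa [hqdef, div_lt_one hN]
  have hs0 : 0 ≤ s := by linarith
  have hqs : q * s ≤ i := by nlinarith [mul_nonneg hδ.le hs0]
  set w : ℝ := N - s - (u - (i + 1)) with hwdef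
  -- positivity of `w`
  have hus : u * s ≤ i * N := by
    have := mul_le_mul_of_nonneg_right hqs hN.le
    rw [mul_comm q s, mul_assoc, hqN] at this
    linarith
  have hw : 0 < w := by
    rw [hwdef]
    nlinarith [mul_nonneg (sub_nonneg.2 huN.le) (sub_nonneg.2 hsN)]
  -- the two fraction bounds
  have F1 : (s - i) * (q + δ) ≤ (1 - q - δ) * i := by nlinarith
  have F2 : (u - i) * (1 - q) ≤ q * w := by
    rw [hwdef]
    nlinarith
  have hsi : 0 ≤ s - i := by linarith
  have hui : 0 ≤ u - i := by linarith
  have hpos1 : 0 < q + δ := by linarith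
  have h1q : 0 < 1 - q := by linarith
  have hrhs1 : 0 ≤ (1 - q - δ) * i := le_trans (mul_nonneg hsi hpos1.le) F1
  have F12 : (s - i) * (q + δ) * ((u - i) * (1 - q)) ≤ (1 - q - δ) * i * (q * w) :=
    mul_le_mul F1 F2 (mul_nonneg hui h1q.le) hrhs1
  -- the constant: q (1 - q - δ) ≤ (1 - 2δ) (q + δ) (1 - q)
  have K : q * (1 - q - δ) ≤ (1 - 2 * δ) * ((q + δ) * (1 - q)) := by
    nlinarith [two_mul_q_ineq hq0 hδ.le hδ4]
  -- combine: (s - i)(u - i) ≤ (1 - 2δ) i w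
  have hcw : 0 < (q + δ) * (1 - q) := mul_pos hpos1 h1q
  have step : (s - i) * (u - i) * ((q + δ) * (1 - q)) ≤
      (1 - 2 * δ) * (i * w) * ((q + δ) * (1 - q)) := by
    calc (s - i) * (u - i) * ((q + δ) * (1 - q))
        = (s - i) * (q + δ) * ((u - i) * (1 - q)) := by ring
      _ ≤ (1 - q - δ) * i * (q * w) := F12
      _ = (q * (1 - q - δ)) * (i * w) := by ring
      _ ≤ (1 - 2 * δ) * ((q + δ) * (1 - q)) * (i * w) :=
          mul_le_mul_of_nonneg_right K (mul_nonneg hi0 hw.le)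
      _ = _ := by ring
  have main : (s - i) * (u - i) ≤ (1 - 2 * δ) * (i * w) := le_of_mul_le_mul_right step hcw
  have h2δ : 0 ≤ 1 - 2 * δ := by linarith
  have main' : (s - i) * (u - i) ≤ (1 - 2 * δ) * ((i + 1) * w) := by
    have : (1 - 2 * δ) * (i * w) ≤ (1 - 2 * δ) * ((i + 1) * w) :=
      mul_le_mul_of_nonneg_left (by nlinarith) h2δ
    linarith
  have hiw : 0 < (i + 1) * w := mul_pos (by linarith) hw
  have hfin : A * ((i + 1) * w) ≤ (1 - 2 * δ) * B * ((i + 1) * w) := by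
    calc A * ((i + 1) * w) = B * ((s - i) * (u - i)) := hid
      _ ≤ B * ((1 - 2 * δ) * ((i + 1) * w)) := mul_le_mul_of_nonneg_left main' hB0
      _ = _ := by ring
  exact le_of_mul_le_mul_right hfin hiw

/-- **The ratio step of the hypergeometric upper tail.** Beyond the point `(u/N + δ)|S|` the
numbers `cnt S u i` decay geometrically with ratio `1 - 2δ`. [folklore] -/
theorem cnt_succ_le (S : Finset α) {u : ℕ} (hu : u < Fintype.card α) {δ : ℝ} (hδ : 0 < δ)
    (hδ4 : δ ≤ 1 / 4) {i : ℕ} (hi : ((u : ℝ) / Fintype.card α + δ) * S.card ≤ i) :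
    (cnt S u (i + 1) : ℝ) ≤ (1 - 2 * δ) * cnt S u i := by
  have hN : (0 : ℝ) < Fintype.card α := by exact_mod_cast lt_of_le_of_lt (Nat.zero_le u) hu
  have hsN : S.card ≤ Fintype.card α := card_le_univ S
  by_cases hz : cnt S u (i + 1) = 0
  · rw [hz, Nat.cast_zero]
    exact mul_nonneg (by linarith) (Nat.cast_nonneg _)
  obtain ⟨U, hU⟩ : (((univ : Finset α).powersetCard u).filter
      (fun U => (U ∩ S).card = i + 1)).Nonempty := Finset.card_ne_zero.1 hz
  rw [mem_filter, mem_powersetCard] at hU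
  obtain ⟨⟨-, hUcard⟩, hUS⟩ := hU
  have h1 : i + 1 ≤ S.card := hUS ▸ card_le_card inter_subset_right
  have h2 : i + 1 ≤ u := hUS ▸ hUcard ▸ card_le_card inter_subset_left
  have h3 : u - (i + 1) ≤ Fintype.card α - S.card := by
    have hc := card_le_card (show U \ S ⊆ Sᶜ from fun x hx => mem_compl.2 (mem_sdiff.1 hx).2)
    rw [card_compl] at hc
    have := Finset.card_sdiff_add_card_inter U S
    omega
  -- the exact identity between consecutive levels
  have hid : cnt S u (i + 1) * ((i + 1) * (Fintype.card α - S.card - (u - (i + 1)))) =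
      cnt S u i * ((S.card - i) * (u - i)) := by
    rw [cnt_eq S h2, cnt_eq S (by omega : i ≤ u)]
    have e1 := Nat.choose_succ_right_eq S.card i
    have e2 := Nat.choose_succ_right_eq (Fintype.card α - S.card) (u - (i + 1))
    rw [show u - (i + 1) + 1 = u - i by omega] at e2
    calc S.card.choose (i + 1) * ((Fintype.card α - S.card).choose (u - (i + 1))) *
          ((i + 1) * (Fintype.card α - S.card - (u - (i + 1))))
        = (S.card.choose (i + 1) * (i + 1)) *
            ((Fintype.card α - S.card).choose (u - (i + 1)) *
              (Fintype.card α - S.card - (u - (i + 1)))) := by ring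
      _ = (S.card.choose i * (S.card - i)) * ((Fintype.card α - S.card).choose (u - i) * (u - i)) := by
          rw [e1, ← e2]
      _ = _ := by ring
  generalize hA : cnt S u (i + 1) = A at hid
  generalize hB : cnt S u i = B at hid
  have hidR := congrArg (fun n : ℕ => (n : ℝ)) hid
  simp only [Nat.cast_mul, Nat.cast_add, Nat.cast_one, Nat.cast_sub h3, Nat.cast_sub hsN,
    Nat.cast_sub h2, Nat.cast_sub (by omega : i ≤ S.card), Nat.cast_sub (by omega : i ≤ u)]
    at hidR
  refine ratio_real hN hδ hδ4 (by exact_mod_cast hu) (by exact_mod_cast hsN) (Nat.cast_nonneg _)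
    (by exact_mod_cast h1) (by exact_mod_cast h2) (Nat.cast_nonneg _) hi ?_
  linarith [hidR]

/-- Geometric decay of the levels above `⌈(u/N + δ)|S|⌉`. [folklore] -/
theorem cnt_add_le (S : Finset α) {u : ℕ} (hu : u < Fintype.card α) {δ : ℝ} (hδ : 0 < δ)
    (hδ4 : δ ≤ 1 / 4) {i₁ : ℕ} (hi₁ : ((u : ℝ) / Fintype.card α + δ) * S.card ≤ i₁) (r : ℕ) :
    (cnt S u (i₁ + r) : ℝ) ≤ (1 - 2 * δ) ^ r * cnt S u i₁ := by
  induction r with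
  | zero => simp
  | succ r ih =>
    have hi : ((u : ℝ) / Fintype.card α + δ) * S.card ≤ (i₁ + r : ℕ) := by
      refine hi₁.trans ?_
      exact_mod_cast Nat.le_add_right i₁ r
    calc (cnt S u (i₁ + (r + 1)) : ℝ) = cnt S u (i₁ + r + 1) := by rw [Nat.add_assoc]
      _ ≤ (1 - 2 * δ) * cnt S u (i₁ + r) := cnt_succ_le S hu hδ hδ4 hi
      _ ≤ (1 - 2 * δ) * ((1 - 2 * δ) ^ r * cnt S u i₁) :=
          mul_le_mul_of_nonneg_left ih (by linarith)
      _ = _ := by ring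

/-- **Hypergeometric upper tail, counting form.** The number of `u`-subsets `U` of an
`N`-element universe with `|U ∩ S| ≥ t`, `t ≥ (u/N + 2δ)|S|`, is at most
`C(N, u) · (1 - 2δ)^{⌊δ |S|⌋} / (2δ)` (`0 < δ ≤ 1/4`, `u < N`). (AKV use the bound of
[AlonKumarVolk2020, Lemma 6] = Skala 2013; this elementary ratio argument suffices here.)
[cite: AlonKumarVolk2020, Lemma 6] -/
theorem card_upperTail_le (S : Finset α) {u : ℕ} (hu : u < Fintype.card α) {δ : ℝ} (hδ : 0 < δ)
    (hδ4 : δ ≤ 1 / 4) {t : ℕ} (ht : ((u : ℝ) / Fintype.card α + 2 * δ) * S.card ≤ t) :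
    ((((univ : Finset α).powersetCard u).filter (fun U => t ≤ (U ∩ S).card)).card : ℝ) ≤
      (Fintype.card α).choose u * (1 - 2 * δ) ^ ⌊δ * S.card⌋₊ / (2 * δ) := by
  set N := Fintype.card α with hNdef
  set ρ : ℝ := 1 - 2 * δ with hρ
  have hρ0 : 0 ≤ ρ := by rw [hρ]; linarith
  have hρ1 : ρ < 1 := by rw [hρ]; linarith
  have hs0 : (0 : ℝ) ≤ S.card := Nat.cast_nonneg _
  set i₁ : ℕ := ⌈((u : ℝ) / N + δ) * S.card⌉₊ with hi₁def
  have hi₁ : ((u : ℝ) / N + δ) * S.card ≤ i₁ := Nat.le_ceil _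
  have hq0 : (0 : ℝ) ≤ (u : ℝ) / N := by positivity
  -- `⌊δ s⌋ + i₁ ≤ t`
  have hgap : ⌊δ * (S.card : ℝ)⌋₊ + i₁ ≤ t := by
    have h1 : (⌊δ * (S.card : ℝ)⌋₊ : ℝ) ≤ δ * S.card := Nat.floor_le (mul_nonneg hδ.le hs0)
    have h2 : (i₁ : ℝ) < ((u : ℝ) / N + δ) * S.card + 1 :=
      Nat.ceil_lt_add_one (mul_nonneg (by linarith) hs0)
    have h3 : (⌊δ * (S.card : ℝ)⌋₊ : ℝ) + i₁ < t + 1 := by nlinarith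
    have h4 : ⌊δ * (S.card : ℝ)⌋₊ + i₁ < t + 1 := by exact_mod_cast h3
    omega
  -- decompose the tail by the value of `|U ∩ S|`
  set A := ((univ : Finset α).powersetCard u).filter (fun U => t ≤ (U ∩ S).card) with hA
  have hfib : A.card = ∑ b ∈ Finset.Icc t u, (A.filter (fun U => (U ∩ S).card = b)).card := by
    refine Finset.card_eq_sum_card_fiberwise (f := fun U => (U ∩ S).card) fun U hU => ?_
    rw [mem_coe, hA, mem_filter, mem_powersetCard] at hU
    rw [mem_coe, Finset.mem_Icc]
    exact ⟨hU.2, hU.1.2 ▸ card_le_card inter_subset_left⟩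
  have hfib_le : ∀ b, (A.filter (fun U => (U ∩ S).card = b)).card ≤ cnt S u b := by
    intro b
    apply card_le_card
    intro U hU
    rw [mem_filter, hA, mem_filter] at hU
    exact mem_filter.2 ⟨hU.1.1, hU.2⟩
  have step1 : (A.card : ℝ) ≤ ∑ b ∈ Finset.Icc t u, (cnt S u b : ℝ) := by
    rw [hfib]
    push_cast
    exact Finset.sum_le_sum fun b _ => by exact_mod_cast hfib_le b
  have step2 : ∀ b ∈ Finset.Icc t u, (cnt S u b : ℝ) ≤ ρ ^ (b - i₁) * N.choose u := by
    intro b hb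
    rw [Finset.mem_Icc] at hb
    have hb' : b = i₁ + (b - i₁) := by omega
    calc (cnt S u b : ℝ) = cnt S u (i₁ + (b - i₁)) := by rw [← hb']
      _ ≤ ρ ^ (b - i₁) * cnt S u i₁ := cnt_add_le S hu hδ hδ4 hi₁ _
      _ ≤ ρ ^ (b - i₁) * N.choose u := by
          apply mul_le_mul_of_nonneg_left _ (pow_nonneg hρ0 _)
          exact_mod_cast cnt_le_choose S u i₁
  have step3 : ∑ b ∈ Finset.Icc t u, ρ ^ (b - i₁) ≤ ρ ^ ⌊δ * (S.card : ℝ)⌋₊ / (2 * δ) := by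
    have hre : ∑ b ∈ Finset.Icc t u, ρ ^ (b - i₁) =
        ∑ c ∈ Finset.Ico (t - i₁) (u + 1 - i₁), ρ ^ c := by
      refine Finset.sum_nbij' (fun b => b - i₁) (fun c => c + i₁) ?_ ?_ ?_ ?_ (fun _ _ => rfl)
      · intro b hb
        rw [Finset.mem_Icc] at hb
        rw [Finset.mem_Ico]
        omega
      · intro c hc
        rw [Finset.mem_Ico] at hc
        rw [Finset.mem_Icc]
        omega
      · intro b hb
        rw [Finset.mem_Icc] at hb
        show b - i₁ + i₁ = b
        omega
      · intro c _
        show c + i₁ - i₁ = c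
        omega
    rw [hre]
    calc ∑ c ∈ Finset.Ico (t - i₁) (u + 1 - i₁), ρ ^ c ≤ ρ ^ (t - i₁) / (1 - ρ) :=
          geom_sum_Ico_le_of_lt_one hρ0 hρ1
      _ ≤ ρ ^ ⌊δ * (S.card : ℝ)⌋₊ / (2 * δ) := by
          rw [show 1 - ρ = 2 * δ by rw [hρ]; ring]
          apply div_le_div_of_nonneg_right _ (by linarith)
          exact pow_le_pow_of_le_one hρ0 hρ1.le (by omega)
  calc (A.card : ℝ) ≤ ∑ b ∈ Finset.Icc t u, (cnt S u b : ℝ) := step1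
    _ ≤ ∑ b ∈ Finset.Icc t u, ρ ^ (b - i₁) * N.choose u := Finset.sum_le_sum step2
    _ = (N.choose u : ℝ) * ∑ b ∈ Finset.Icc t u, ρ ^ (b - i₁) := by
        rw [Finset.mul_sum]
        exact Finset.sum_congr rfl fun _ _ => mul_comm _ _
    _ ≤ (N.choose u : ℝ) * (ρ ^ ⌊δ * (S.card : ℝ)⌋₊ / (2 * δ)) :=
        mul_le_mul_of_nonneg_left step3 (Nat.cast_nonneg _)
    _ = _ := by ring

/-- **Hypergeometric lower tail, counting form** (by complementation `U ↦ Uᶜ` from the upper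
tail): the number of `u`-subsets `U` with `|U ∩ S| ≤ x`, `x ≤ (u/N - 2δ)|S|`, is at most
`C(N, u) · (1 - 2δ)^{⌊δ|S|⌋} / (2δ)` (`0 < u ≤ N`). [cite: AlonKumarVolk2020, Lemma 6] -/
theorem card_lowerTail_le (S : Finset α) {u : ℕ} (hu0 : 0 < u) (huN : u ≤ Fintype.card α)
    {δ : ℝ} (hδ : 0 < δ) (hδ4 : δ ≤ 1 / 4) {x : ℕ}
    (hx : (x : ℝ) ≤ ((u : ℝ) / Fintype.card α - 2 * δ) * S.card) :
    ((((univ : Finset α).powersetCard u).filter (fun U => (U ∩ S).card ≤ x)).card : ℝ) ≤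
      (Fintype.card α).choose u * (1 - 2 * δ) ^ ⌊δ * S.card⌋₊ / (2 * δ) := by
  set N := Fintype.card α with hNdef
  have hN : (0 : ℝ) < N := by exact_mod_cast lt_of_lt_of_le hu0 huN
  have hu' : N - u < N := by omega
  have hs0 : (0 : ℝ) ≤ S.card := Nat.cast_nonneg _
  -- the threshold for the complement
  have hxs : x ≤ S.card := by
    have h1 : (x : ℝ) ≤ S.card := by
      refine hx.trans ?_
      have hq1 : (u : ℝ) / N ≤ 1 := by
        rw [div_le_one hN]; exact_mod_cast huN
      nlinarith
    exact_mod_cast h1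
  have ht : (((N - u : ℕ) : ℝ) / N + 2 * δ) * S.card ≤ (S.card - x : ℕ) := by
    rw [Nat.cast_sub hxs, Nat.cast_sub huN]
    have : ((N : ℝ) - u) / N = 1 - (u : ℝ) / N := by
      field_simp
    rw [this]
    nlinarith
  have key := card_upperTail_le S hu' hδ hδ4 ht
  rw [Nat.choose_symm huN] at key
  refine le_trans ?_ key
  have hle : (((univ : Finset α).powersetCard u).filter (fun U => (U ∩ S).card ≤ x)).card ≤
      (((univ : Finset α).powersetCard (N - u)).filter
        (fun U => S.card - x ≤ (U ∩ S).card)).card := by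
    refine Finset.card_le_card_of_injOn (fun U => Uᶜ) ?_ ?_
    · intro U hU
      rw [mem_coe, mem_filter, mem_powersetCard] at hU
      rw [mem_coe, mem_filter, mem_powersetCard]
      refine ⟨⟨subset_univ _, by rw [card_compl, hU.1.2]⟩, ?_⟩
      have h1 : Uᶜ ∩ S = S \ U := by
        ext y
        simp only [mem_inter, mem_compl, mem_sdiff]
        tauto
      have h2 := Finset.card_sdiff_add_card_inter S U
      rw [h1]
      rw [inter_comm] at h2
      have h3 := hU.2
      omega
    · intro U _ V _ hUV
      exact compl_injective hUV
  exact_mod_cast hle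

end Tail



/-! ### The unbalancing theorem -/

section Unbalancing

/-- Numerical constant: `(15/16)^{11} ≤ 1/2`. [folklore] -/
theorem fifteen_sixteenth_pow : ((15 : ℝ) / 16) ^ 11 ≤ 1 / 2 := by norm_num

variable {N : ℕ}

/-- **A set of prescribed size hitting every member of a family in the expected proportion**
(tails + union bound): for `|F'| < 2^τ` sets of size `≥ 352(τ+8)` there is a `u`-set `U` with
`(u/N - 1/16)|S| < |U ∩ S| < (u/N + 1/16)|S|` for all `S ∈ F'`. (Replaces the random choices
of [AlonKumarVolk2020, Lemma 10 / Lemma 15].) [cite: AlonKumarVolk2020, Lemma 10] -/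
theorem exists_goodU (τ u : ℕ) (hu0 : 0 < u) (huN : u < N) (h16 : N ≤ 16 * u)
    (F' : Finset (Finset (Fin N))) (hF' : ∀ S ∈ F', 352 * (τ + 8) ≤ S.card)
    (hcard : F'.card < 2 ^ τ) :
    ∃ U : Finset (Fin N), U.card = u ∧ ∀ S ∈ F',
      ⌊((u : ℝ) / N - 2 * (1 / 32)) * S.card⌋₊ < (U ∩ S).card ∧
        (U ∩ S).card < ⌈((u : ℝ) / N + 2 * (1 / 32)) * S.card⌉₊ := by
  classical
  have hN0 : 0 < N := lt_trans hu0 huN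
  have hN : (0 : ℝ) < N := by exact_mod_cast hN0
  have hδ0 : (0 : ℝ) < 1 / 32 := by norm_num
  have hδ4 : (1 / 32 : ℝ) ≤ 1 / 4 := by norm_num
  have hcardN : Fintype.card (Fin N) = N := Fintype.card_fin N
  have huN' : u < Fintype.card (Fin N) := by rwa [hcardN]
  have huN'' : u ≤ Fintype.card (Fin N) := huN'.le
  -- the bad events
  let lo : Finset (Fin N) → ℕ := fun S => ⌊((u : ℝ) / N - 2 * (1 / 32)) * S.card⌋₊
  let hi : Finset (Fin N) → ℕ := fun S => ⌈((u : ℝ) / N + 2 * (1 / 32)) * S.card⌉₊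
  let bad : Finset (Fin N) → Finset (Finset (Fin N)) := fun S =>
    ((univ : Finset (Fin N)).powersetCard u).filter (fun U => (U ∩ S).card ≤ lo S) ∪
      ((univ : Finset (Fin N)).powersetCard u).filter (fun U => hi S ≤ (U ∩ S).card)
  have hbad : ∀ S ∈ F', ((bad S).card : ℝ) ≤ (N.choose u : ℝ) / 2 ^ (τ + 3) := by
    intro S hS
    have hs := hF' S hS
    have hs0 : (0 : ℝ) ≤ S.card := Nat.cast_nonneg _
    have hq16 : 2 * (1 / 32 : ℝ) ≤ (u : ℝ) / N := by
      rw [le_div_iff₀ hN]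
      have : (N : ℝ) ≤ 16 * u := by exact_mod_cast h16
      linarith
    have hx : ((lo S : ℕ) : ℝ) ≤ ((u : ℝ) / Fintype.card (Fin N) - 2 * (1 / 32)) * S.card := by
      rw [hcardN]; exact Nat.floor_le (mul_nonneg (by linarith) hs0)
    have ht : ((u : ℝ) / Fintype.card (Fin N) + 2 * (1 / 32)) * S.card ≤ (hi S : ℕ) := by
      rw [hcardN]; exact Nat.le_ceil _
    have h1 := card_lowerTail_le S hu0 huN'' hδ0 hδ4 hx
    have h2 := card_upperTail_le S huN' hδ0 hδ4 ht
    rw [hcardN] at h1 h2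
    have hpow : (1 - 2 * (1 / 32 : ℝ)) ^ ⌊(1 / 32 : ℝ) * S.card⌋₊ ≤ (1 / 2) ^ (τ + 8) := by
      have hE : 11 * (τ + 8) ≤ ⌊(1 / 32 : ℝ) * S.card⌋₊ := by
        apply Nat.le_floor
        have : ((352 * (τ + 8) : ℕ) : ℝ) ≤ S.card := by exact_mod_cast hs
        push_cast at this ⊢
        linarith
      calc (1 - 2 * (1 / 32 : ℝ)) ^ ⌊(1 / 32 : ℝ) * S.card⌋₊
          ≤ (1 - 2 * (1 / 32 : ℝ)) ^ (11 * (τ + 8)) :=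
            pow_le_pow_of_le_one (by norm_num) (by norm_num) hE
        _ = (((15 : ℝ) / 16) ^ 11) ^ (τ + 8) := by rw [← pow_mul]; norm_num
        _ ≤ (1 / 2) ^ (τ + 8) := pow_le_pow_left₀ (by positivity) fifteen_sixteenth_pow _
    have hC0 : (0 : ℝ) ≤ N.choose u := Nat.cast_nonneg _
    have hhalf : (1 / 2 : ℝ) ^ (τ + 8) = 1 / (2 ^ (τ + 3) * 32) := by
      rw [one_div_pow, pow_add, pow_add]; ring
    calc ((bad S).card : ℝ) ≤ ((((univ : Finset (Fin N)).powersetCard u).filter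
            (fun U => (U ∩ S).card ≤ lo S)).card : ℝ) +
          ((((univ : Finset (Fin N)).powersetCard u).filter
            (fun U => hi S ≤ (U ∩ S).card)).card : ℝ) := by
          exact_mod_cast Finset.card_union_le _ _
      _ ≤ 2 * ((N.choose u : ℝ) * (1 - 2 * (1 / 32)) ^ ⌊(1 / 32 : ℝ) * S.card⌋₊ /
            (2 * (1 / 32))) := by linarith
      _ ≤ 2 * ((N.choose u : ℝ) * (1 / 2) ^ (τ + 8) / (2 * (1 / 32))) := by gcongr
      _ = (N.choose u : ℝ) / 2 ^ (τ + 3) := by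
          rw [hhalf]; field_simp
  set BAD := F'.biUnion bad with hBAD
  have hBADcard : (BAD.card : ℝ) < ((univ : Finset (Fin N)).powersetCard u).card := by
    have h1 : (BAD.card : ℝ) ≤ ∑ S ∈ F', ((bad S).card : ℝ) := by
      exact_mod_cast Finset.card_biUnion_le
    have h2 : ∑ S ∈ F', ((bad S).card : ℝ) ≤ F'.card • ((N.choose u : ℝ) / 2 ^ (τ + 3)) :=
      Finset.sum_le_card_nsmul _ _ _ hbad
    rw [nsmul_eq_mul] at h2
    have h3 : (F'.card : ℝ) ≤ 2 ^ τ := by exact_mod_cast hcard.le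
    have hCpos : (0 : ℝ) < N.choose u := by exact_mod_cast Nat.choose_pos huN.le
    rw [card_powersetCard, card_univ, hcardN]
    calc (BAD.card : ℝ) ≤ F'.card * ((N.choose u : ℝ) / 2 ^ (τ + 3)) := h1.trans h2
      _ ≤ 2 ^ τ * ((N.choose u : ℝ) / 2 ^ (τ + 3)) :=
          mul_le_mul_of_nonneg_right h3 (by positivity)
      _ = (N.choose u : ℝ) / 8 := by rw [pow_add]; field_simp; ring
      _ < N.choose u := by linarith
  have hBADcard' : BAD.card < ((univ : Finset (Fin N)).powersetCard u).card := by
    exact_mod_cast hBADcard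
  obtain ⟨U, hU, hUB⟩ : ∃ U ∈ (univ : Finset (Fin N)).powersetCard u, U ∉ BAD := by
    by_contra h
    push Not at h
    exact absurd (card_le_card h) (not_le.2 hBADcard')
  refine ⟨U, (mem_powersetCard.1 hU).2, fun S hS => ?_⟩
  have hUS : U ∉ bad S := fun h => hUB (Finset.mem_biUnion.2 ⟨S, hS, h⟩)
  simp only [bad, mem_union, mem_filter, not_or, not_and, not_le] at hUS
  exact ⟨hUS.1 hU, hUS.2 hU⟩

/-- The real arithmetic turning `(u/N ∓ 1/16)|S|`-windows (`u = N/2 + p`, `N < 8p`,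
`2|S| ≤ N`, `|S| ≥ 352(τ+8)`) into `4τ ≤ 2|U ∩ S| - |S| ≤ 2p - 4τ`. [folklore] -/
theorem window_real {N p n2 s c τ : ℝ} (hN2 : N = 2 * n2) (hNpos : 0 < N) (h8p : N < 8 * p)
    (h2s : 2 * s ≤ N) (hsbig : 352 * (τ + 8) ≤ s) (hτ : 0 ≤ τ)
    (hlow : ((n2 + p) / N - 2 * (1 / 32)) * s < c) (hup : c < ((n2 + p) / N + 2 * (1 / 32)) * s) :
    4 * τ ≤ 2 * c - s ∧ 2 * c - s ≤ 2 * p - 4 * τ := by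
  have hs0 : 0 ≤ s := by nlinarith
  have hp0 : 0 < p := by nlinarith
  have hn2s : n2 * s = N * s / 2 := by rw [hN2]; ring
  have hlow' : ((n2 + p) - N / 16) * s < c * N := by
    have h := mul_lt_mul_of_pos_right hlow hNpos
    have e : ((n2 + p) / N - 2 * (1 / 32)) * s * N = ((n2 + p) - N / 16) * s := by
      field_simp
      ring
    linarith
  have hup' : c * N < ((n2 + p) + N / 16) * s := by
    have h := mul_lt_mul_of_pos_right hup hNpos
    have e : ((n2 + p) / N + 2 * (1 / 32)) * s * N = ((n2 + p) + N / 16) * s := by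
      field_simp
      ring
    linarith
  have hNs : N * s ≤ 8 * p * s := mul_le_mul_of_nonneg_right h8p.le hs0
  constructor
  · have e1 : (2 * c - s) * N > s * N / 8 := by nlinarith
    have e2 : 2 * c - s > s / 8 := by
      by_contra h
      push Not at h
      nlinarith [mul_le_mul_of_nonneg_right h hNpos.le]
    nlinarith
  · have f1 : (2 * c - s) * N < (N / 8 + 2 * p) * s := by nlinarith
    have f2 : (N / 8 + 2 * p) * s ≤ (N / 8 + 2 * p) * (N / 2) :=
      mul_le_mul_of_nonneg_left (by linarith) (by positivity)
    have hNN : N * N < 8 * p * N := mul_lt_mul_of_pos_right h8p hNpos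
    have f3 : (2 * c - s) * N < (3 * p / 2) * N := by nlinarith
    have f4 : 2 * c - s < 3 * p / 2 := lt_of_mul_lt_mul_right f3 hNpos.le
    have hp44 : 44 * (τ + 8) < p := by nlinarith
    nlinarith

/-- **Unbalancing sets under a balanced partition** ([AlonKumarVolk2020, Thm. 3 / Thm. 13]
with constants adequate for Theorem 20, every large even `N`, no prime-gap input): if `F` is a
family of subsets of an `N`-set, `N` even, with `352(τ+8) ≤ |S| ≤ N - 352(τ+8)` for all
`S ∈ F`, `N ≤ 2^τ` and `16 τ |F| < N`, then there is a balanced `Y` (`2|Y| = N`) which is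
`τ`-unbalanced on every member: `|2|Y ∩ S| - |S|| ≥ 2τ`, i.e. `||Y ∩ S| - |S|/2| ≥ τ`.
[cite: AlonKumarVolk2020, Thm. 13] -/
theorem exists_balanced_unbalancing (τ : ℕ) (hNe : Even N) (F : Finset (Finset (Fin N)))
    (hF : ∀ S ∈ F, 352 * (τ + 8) ≤ S.card ∧ S.card + 352 * (τ + 8) ≤ N)
    (hNτ : N ≤ 2 ^ τ) (hfew : 16 * τ * F.card < N) :
    ∃ Y : Finset (Fin N), 2 * Y.card = N ∧
      ∀ S ∈ F, (2 * τ : ℤ) ≤ |2 * ((Y ∩ S).card : ℤ) - S.card| := by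
  classical
  obtain ⟨n2, hn2⟩ := hNe
  -- the trivial case `F = ∅`
  rcases F.eq_empty_or_nonempty with rfl | ⟨S₀, hS₀⟩
  · obtain ⟨Y, -, hY⟩ := Finset.exists_subset_card_eq
      (show n2 ≤ (univ : Finset (Fin N)).card by rw [card_univ, Fintype.card_fin]; omega)
    exact ⟨Y, by omega, by simp⟩
  have hNbig : 352 * (τ + 8) * 2 ≤ N := by have := hF S₀ hS₀; omega
  have hτ1 : 1 ≤ τ := by
    rcases Nat.eq_zero_or_pos τ with rfl | h
    · simp at hNτ; omega
    · exact h
  have hFN : F.card < N := by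
    have : F.card ≤ 16 * τ * F.card := Nat.le_mul_of_pos_left _ (by omega)
    omega
  -- a Bertrand prime `p ∈ (N/8, N/4]`
  obtain ⟨p, hp, hp1, hp2⟩ := Nat.exists_prime_lt_and_le_two_mul (N / 8) (by omega)
  have h8p : N < 8 * p := by omega
  have h4p : 4 * p ≤ N := by omega
  have hp5 : 5 ≤ p := by omega
  haveI : Fact p.Prime := ⟨hp⟩
  set k := n2 / p with hk
  set r := n2 % p with hr
  have hkr : n2 = p * k + r := (Nat.div_add_mod n2 p).symm
  have hrp : r < p := Nat.mod_lt _ hp.pos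
  have hk2 : 2 ≤ k := (Nat.le_div_iff_mul_le hp.pos).2 (by omega)
  have hk3 : k ≤ 3 := Nat.lt_succ_iff.1 ((Nat.div_lt_iff_lt_mul hp.pos).2 (by omega))
  have hpk : ¬ p ∣ k := fun h => by
    have := Nat.le_of_dvd (by omega) h
    omega
  set u := n2 + p with hu
  have hu0 : 0 < u := by omega
  have huN : u < N := by omega
  have h16u : N ≤ 16 * u := by omega
  -- suppose every balanced `Y` balances some member
  by_contra hcon
  push Not at hcon
  -- small representatives of the members
  let sm : Finset (Fin N) → Finset (Fin N) := fun S => if 2 * S.card ≤ N then S else Sᶜ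
  have hsm_card : ∀ S ∈ F, 352 * (τ + 8) ≤ (sm S).card ∧ 2 * (sm S).card ≤ N := by
    intro S hS
    have h := hF S hS
    by_cases h2 : 2 * S.card ≤ N
    · simp only [sm, if_pos h2]
      exact ⟨h.1, h2⟩
    · simp only [sm, if_neg h2, Finset.card_compl, Fintype.card_fin]
      omega
  set F' := F.image sm with hF'
  have hF'card : F'.card < 2 ^ τ :=
    lt_of_le_of_lt Finset.card_image_le (lt_of_lt_of_le hFN hNτ)
  obtain ⟨U, hUcard, hUgood⟩ := exists_goodU τ u hu0 huN h16u F'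
    (fun S' hS' => by
      obtain ⟨S, hS, rfl⟩ := Finset.mem_image.1 hS'
      exact (hsm_card S hS).1) hF'card
  -- the windows for the small representatives
  have hNR : (N : ℝ) = 2 * n2 := by exact_mod_cast (show N = 2 * n2 by omega)
  have hNpos : (0 : ℝ) < N := by exact_mod_cast (show 0 < N by omega)
  have h8pR : (N : ℝ) < 8 * p := by exact_mod_cast h8p
  have huR : (u : ℝ) = n2 + p := by rw [hu]; push_cast; ring
  have hwin' : ∀ S ∈ F, (4 * τ : ℤ) ≤ 2 * ((U ∩ sm S).card : ℤ) - (sm S).card ∧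
      2 * ((U ∩ sm S).card : ℤ) - (sm S).card ≤ 2 * p - 4 * τ := by
    intro S hS
    obtain ⟨hlo, hhi⟩ := hUgood (sm S) (Finset.mem_image_of_mem sm hS)
    obtain ⟨hs1, hs2⟩ := hsm_card S hS
    have hs0 : (0 : ℝ) ≤ (sm S).card := Nat.cast_nonneg _
    have hq16 : 2 * (1 / 32 : ℝ) ≤ (u : ℝ) / N := by
      rw [le_div_iff₀ hNpos]
      have : (N : ℝ) ≤ 16 * u := by exact_mod_cast h16u
      linarith
    have hlowR : ((u : ℝ) / N - 2 * (1 / 32)) * (sm S).card < (U ∩ sm S).card :=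
      (Nat.floor_lt (mul_nonneg (by linarith) hs0)).1 hlo
    have hupR : ((U ∩ sm S).card : ℝ) < ((u : ℝ) / N + 2 * (1 / 32)) * (sm S).card :=
      Nat.lt_ceil.1 hhi
    rw [huR] at hlowR hupR
    have h2sR : 2 * ((sm S).card : ℝ) ≤ N := by exact_mod_cast hs2
    have hsbigR : 352 * ((τ : ℝ) + 8) ≤ (sm S).card := by exact_mod_cast hs1
    obtain ⟨w1, w2⟩ := window_real hNR hNpos h8pR h2sR hsbigR (Nat.cast_nonneg τ) hlowR hupR
    constructor
    · exact_mod_cast w1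
    · exact_mod_cast w2
  -- the windows for all members
  have h2u : 2 * u = N + 2 * p := by omega
  have hwin : ∀ S ∈ F, (4 * τ : ℤ) ≤ 2 * ((U ∩ S).card : ℤ) - S.card ∧
      2 * ((U ∩ S).card : ℤ) - S.card ≤ 2 * p - 4 * τ := by
    intro S hS
    have h := hwin' S hS
    by_cases h2 : 2 * S.card ≤ N
    · simpa only [sm, if_pos h2] using h
    · simp only [sm, if_neg h2] at h
      have e1 : U ∩ Sᶜ = U \ S := by
        ext x
        simp only [mem_inter, mem_compl, mem_sdiff]
      have e2 := Finset.card_sdiff_add_card_inter U S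
      have e3 : (Sᶜ).card = N - S.card := by rw [Finset.card_compl, Fintype.card_fin]
      have e4 : S.card ≤ N := by
        have := Finset.card_le_univ S
        rwa [Fintype.card_fin] at this
      rw [e1, e3] at h
      omega
  -- fix `r` points `B ⊆ U`; `T = U ∖ B` has `(k+1)p` points
  obtain ⟨B, hBU, hBcard⟩ := Finset.exists_subset_card_eq (show r ≤ U.card by omega)
  set T := U \ B with hT
  have hTcard : T.card = (k + 1) * p := by
    rw [hT, Finset.card_sdiff_of_subset hBU, hUcard, hBcard, hu, hkr, Nat.add_mul, one_mul]
    have : r ≤ p * k + r + p := by omega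
    zify [this]
    ring
  -- the auxiliary polynomial over `𝔽_p`
  let W : Finset (Fin N) → Finset ℕ := fun S =>
    (Finset.range (S.card + 1)).filter (fun a => S.card < 2 * a + 2 * τ ∧ 2 * a < S.card + 2 * τ)
  let lin : Finset (Fin N) → MvPolynomial (Fin N) (ZMod p) := fun S =>
    ∑ i ∈ S \ B, X i + C (((S ∩ B).card : ℕ) : ZMod p)
  let P : MvPolynomial (Fin N) (ZMod p) :=
    ∏ S ∈ F, ∏ a ∈ W S, (lin S - C ((a : ℕ) : ZMod p))
  -- degree
  have hWcard : ∀ S ∈ F, (W S).card ≤ 2 * τ := by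
    intro S hS
    have hs := (hF S hS).1
    calc (W S).card ≤ (Finset.Ico ((S.card - 2 * τ) / 2 + 1)
          ((S.card - 2 * τ) / 2 + 1 + 2 * τ)).card := by
          apply card_le_card
          intro a ha
          simp only [W, mem_filter, mem_range] at ha
          rw [Finset.mem_Ico]
          omega
      _ = 2 * τ := by simp
  have hdegfac : ∀ S a, (lin S - C ((a : ℕ) : ZMod p)).totalDegree ≤ 1 := by
    intro S a
    refine (totalDegree_sub _ _).trans (max_le ?_ (by rw [totalDegree_C]; exact Nat.zero_le _))
    refine (totalDegree_add _ _).trans (max_le ?_ (by rw [totalDegree_C]; exact Nat.zero_le _))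
    refine (totalDegree_finsetSum _ _).trans (Finset.sup_le fun i _ => ?_)
    rw [totalDegree_X]
  have hdegP : P.totalDegree < p := by
    calc P.totalDegree ≤ ∑ S ∈ F, (∏ a ∈ W S, (lin S - C ((a : ℕ) : ZMod p))).totalDegree :=
          totalDegree_finsetProd F (fun S => ∏ a ∈ W S, (lin S - C ((a : ℕ) : ZMod p)))
      _ ≤ ∑ S ∈ F, ∑ a ∈ W S, (lin S - C ((a : ℕ) : ZMod p)).totalDegree := by
          gcongr with S _
          exact totalDegree_finsetProd _ _
      _ ≤ ∑ S ∈ F, ∑ a ∈ W S, (1 : ℕ) := by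
          gcongr with S _ a _
          exact hdegfac S a
      _ = ∑ S ∈ F, (W S).card := by simp
      _ ≤ ∑ S ∈ F, 2 * τ := Finset.sum_le_sum hWcard
      _ = F.card * (2 * τ) := by simp
      _ < p := by nlinarith
  -- evaluation of the linear factors at an indicator vector
  have hlin : ∀ (Z : Finset (Fin N)) (S : Finset (Fin N)),
      eval (indVec (p := p) Z) (lin S) =
        ((((S \ B).filter (fun i => i ∈ Z)).card + (S ∩ B).card : ℕ) : ZMod p) := by
    intro Z S
    simp only [lin, map_add, map_sum, eval_X, eval_C, indVec]
    rw [Finset.sum_boole]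
    push_cast
    ring
  -- vanishing on the layer `kp` of `T`
  have hvan : ∀ Y' ⊆ T, Y'.card = k * p → eval (indVec Y') P = 0 := by
    intro Y' hY'T hY'card
    have hY'B : Disjoint Y' B := Finset.disjoint_of_subset_left hY'T Finset.sdiff_disjoint
    have hYcard : 2 * (Y' ∪ B).card = N := by
      rw [Finset.card_union_of_disjoint hY'B, hY'card, hBcard]
      have : n2 = k * p + r := by rw [hkr]; ring
      omega
    obtain ⟨S, hS, hSbal⟩ := hcon (Y' ∪ B) hYcard
    have haW : ((Y' ∪ B) ∩ S).card ∈ W S := by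
      simp only [W, mem_filter, mem_range]
      refine ⟨Nat.lt_succ_of_le (card_le_card inter_subset_right), ?_⟩
      rw [abs_lt] at hSbal
      omega
    show eval (indVec Y') (∏ S ∈ F, ∏ a ∈ W S, (lin S - C ((a : ℕ) : ZMod p))) = 0
    rw [map_prod]
    apply Finset.prod_eq_zero hS
    rw [map_prod]
    apply Finset.prod_eq_zero haW
    rw [map_sub, eval_C, hlin]
    have hcount : ((S \ B).filter (fun i => i ∈ Y')).card + (S ∩ B).card =
        ((Y' ∪ B) ∩ S).card := by
      have e1 : (S \ B).filter (fun i => i ∈ Y') = Y' ∩ S := by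
        ext x
        simp only [mem_filter, mem_sdiff, mem_inter]
        constructor
        · rintro ⟨⟨hxS, -⟩, hxY⟩
          exact ⟨hxY, hxS⟩
        · rintro ⟨hxY, hxS⟩
          exact ⟨⟨hxS, fun hxB => Finset.disjoint_left.1 hY'B hxY hxB⟩, hxY⟩
      have e2 : (Y' ∪ B) ∩ S = (Y' ∩ S) ∪ (S ∩ B) := by
        ext x
        simp only [mem_union, mem_inter]
        tauto
      have e3 : Disjoint (Y' ∩ S) (S ∩ B) := by
        rw [Finset.disjoint_left]
        rintro x hx hx'
        exact Finset.disjoint_left.1 hY'B (mem_inter.1 hx).1 (mem_inter.1 hx').2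
      rw [e1, e2, Finset.card_union_of_disjoint e3]
    rw [hcount, sub_self]
  -- Hegedűs
  have hT0 : eval (indVec T) P = 0 :=
    eval_indVec_eq_zero_of_layer (by omega) hpk P hdegP T hTcard hvan
  -- but every factor is non-zero at `𝟙_T`
  have hTne : eval (indVec T) P ≠ 0 := by
    show eval (indVec T) (∏ S ∈ F, ∏ a ∈ W S, (lin S - C ((a : ℕ) : ZMod p))) ≠ 0
    rw [map_prod]
    refine Finset.prod_ne_zero_iff.2 fun S hS => ?_
    rw [map_prod]
    refine Finset.prod_ne_zero_iff.2 fun a ha => ?_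
    rw [map_sub, eval_C, hlin]
    have hcountT : ((S \ B).filter (fun i => i ∈ T)).card + (S ∩ B).card = (U ∩ S).card := by
      have e1 : (S \ B).filter (fun i => i ∈ T) = (U ∩ S) \ B := by
        ext x
        simp only [mem_filter, mem_sdiff, mem_inter, hT]
        tauto
      have e2 : S ∩ B = (U ∩ S) ∩ B := by
        ext x
        simp only [mem_inter]
        constructor
        · rintro ⟨hxS, hxB⟩
          exact ⟨⟨hBU hxB, hxS⟩, hxB⟩
        · rintro ⟨⟨-, hxS⟩, hxB⟩
          exact ⟨hxS, hxB⟩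
      rw [e1, e2, Finset.card_sdiff_add_card_inter]
    rw [hcountT]
    obtain ⟨w1, w2⟩ := hwin S hS
    have ha' := ha
    simp only [W, mem_filter, mem_range] at ha'
    have hlt : a ≤ (U ∩ S).card := by omega
    have hdpos : 0 < (U ∩ S).card - a := by omega
    have hdp : (U ∩ S).card - a < p := by omega
    rw [← Nat.cast_sub hlt, Ne, ZMod.natCast_eq_zero_iff]
    intro hdvd
    have := Nat.le_of_dvd hdpos hdvd
    omega
  exact hTne hT0

end Unbalancing

end Literature.Barriers.ValiantsHypothesis.AKV
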